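import Literature.Barriers.QuantumFields.GoldstoneTheoremTensor
import HarnessLib

/-!
# Goldstone's theorem (Kastler–Robinson–Swieca): Lemma I

Support file for the discharge of the named fact
`Literature.Barriers.QuantumFields.KRSLemmaIV` (barrier catalogue `Literature/Barriers/QuantumFields/`,
file `GoldstoneTheorem`). We prove **Lemma I** of Kastler–Robinson–Swieca (Commun. Math. Phys. 2
(1966), p. 112) in the vendored framework `LocalNetWithCurrent` / `IsKRS`: for a strictly local
`A ∈ 𝔄(𝒪_L)` the vacuum expectation of the charge commutator `(Ω, [j^μ(f_R f_d), A] Ω)`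
(`LocalNetWithCurrent.commVEV`) does not depend on the choice of the space cut-off `f_R ∈ 𝒟_R`
(`commVEV_eq_of_spaceCutoff`, by 5(d): the difference of two cut-offs is supported at
`|x⃗| ≥ R`, `|x⁰| ≤ d`, totally spacelike to `𝒪_L` once `R > L + d`,
`areSpacelikeSeparated_shell_krsDiamond`), nor on the time smearing `f_d ∈ 𝒟_d`
(`commVEV_eq_of_timeSmearing`, KRS (13)-(17): `f_{d₁} - f_{d₂} = φ'` for a compactly supported
primitive `φ`, so `f_R (f_{d₁} - f_{d₂}) = ∂₀ (f_R φ)` and by current conservation 5(c)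
`j⁰(∂₀(f_R φ)) Ω = -Σᵢ jⁱ(∂ᵢ f_R φ) Ω`, with `∇f_R` supported in the far shell). As a
consequence the commutator is unchanged under space-time translation of the test function as long
as the translated cut-off still encloses `𝒪_L` with room to spare (`commVEV_compSubConstCLM_eq`),
which is the form used in the proof of Lemma IV (`GoldstoneTheoremProofs`).

The calculus of the product test functions `g ⊗ f` is in `GoldstoneTheoremTensor`.

## References

[KastlerRobinsonSwieca1966] §II 5(c), 5(d), §III Lemma I, (13)-(17).
-/

noncomputable section

open Filter Topology ComplexConjugate MeasureTheory Set
open scoped InnerProductSpace SchwartzMap LineDeriv ContDiff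

namespace Literature.Barriers.QuantumFields

open Literature.MathematicalPhysics.QuantumLattice Literature.Analysis.UnboundedOperators
open LocalNetWithCurrent

/-! ### Linearity of the commutator and the geometry of the far shell -/

/-- `commVEV` is subtractive in the test function (it is `ℂ`-linear in `f`: `j^μ` is linear,
`f ↦ f̄` antilinear and the inner product antilinear in its first slot). [folklore] -/
theorem LocalNetWithCurrent.commVEV_sub (N : LocalNetWithCurrent) (μ : Fin 4)
    (f f' : 𝓢(SpaceTime 3, ℂ)) (A : N.H →L[ℂ] N.H) :
    N.commVEV μ (f - f') A = N.commVEV μ f A - N.commVEV μ f' A := by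
  simp only [commVEV, map_sub, inner_sub_left, inner_sub_right]
  ring

/-- **The far shell is totally spacelike to the double cone**: if `L + δ < R` then every `x` with
`|x⃗| ≥ R`, `|x⁰| ≤ δ` is spacelike to every `y ∈ 𝒪_L = {|y⃗| + |y⁰| < L}`, since
`|x⃗ - y⃗| ≥ R - |y⃗| > δ + |y⁰| ≥ |x⁰ - y⁰|` (KRS p. 113, "unless `R < |x⃗| < R + r` and
`|x⁰| < d₁` … by local commutativity … for `R ≥ L + d₁`").
[cite: KastlerRobinsonSwieca1966, §III proof of Lemma I, (16)] -/
theorem areSpacelikeSeparated_shell_krsDiamond {L δ R : ℝ} (h : L + δ < R) :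
    AreSpacelikeSeparated {x : SpaceTime 3 | R ≤ ‖spaceC 3 x‖ ∧ |x 0| ≤ δ} (krsDiamond L) := by
  intro x hx y hy
  obtain ⟨hxR, hxδ⟩ := hx
  rw [mem_krsDiamond_iff] at hy
  unfold IsSpacelikeSeparated IsSpacelike
  rw [minkowskiForm_self, map_sub, sub_neg]
  have h1 : ‖spaceC 3 x‖ - ‖spaceC 3 y‖ ≤ ‖spaceC 3 x - spaceC 3 y‖ := norm_sub_norm_le _ _
  have h2 : |x 0 - y 0| ≤ |x 0| + |y 0| := abs_sub _ _
  have h3 : |(x - y) 0| < ‖spaceC 3 x - spaceC 3 y‖ := by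
    rw [PiLp.sub_apply]
    linarith [abs_nonneg (y 0)]
  have h4 : 0 ≤ |(x - y) 0| := abs_nonneg _
  calc (x - y) 0 ^ 2 = |(x - y) 0| ^ 2 := (sq_abs _).symm
    _ < ‖spaceC 3 x - spaceC 3 y‖ ^ 2 := by
        exact pow_lt_pow_left₀ h3 h4 two_ne_zero

/-! ### Lemma I: independence of the space cut-off -/

variable {N : LocalNetWithCurrent}

/-- **KRS Lemma I, independence of the space cut-off `f_R`.** For `A ∈ 𝔄(𝒪_L)`, a time
smearing `f_d` supported in `[-d, d]` and two space cut-offs `g ∈ 𝒟_R`, `g' ∈ 𝒟_{R'}` with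
`R, R' > L + d`, the commutators agree: `(Ω, [j^μ(g f_d), A] Ω) = (Ω, [j^μ(g' f_d), A] Ω)` —
the difference `(g - g') ⊗ f_d` is supported at `|x⃗| ≥ min(R, R')`, `|x⁰| ≤ d`, totally spacelike
to `𝒪_L`, so 5(d) applies ("the fact that it is independent of the particular `f_R(x)` and class
`𝒟_R` follows directly from local commutativity").
[cite: KastlerRobinsonSwieca1966, §III Lemma I] -/
theorem commVEV_eq_of_spaceCutoff {m : ℝ} (hN : N.IsKRS m) {L δ R R' : ℝ}
    {A : N.H →L[ℂ] N.H} (hA : A ∈ N.alg (krsDiamond L))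
    {fd : ℝ → ℂ} (hfd : tsupport fd ⊆ Icc (-δ) δ)
    {g g' : EuclideanSpace ℝ (Fin 3) → ℂ} (hg : IsSpaceCutoff R g) (hg' : IsSpaceCutoff R' g')
    {Φ Φ' : 𝓢(SpaceTime 3, ℂ)} (hΦ : ∀ x, Φ x = g (spaceC 3 x) * fd (x 0))
    (hΦ' : ∀ x, Φ' x = g' (spaceC 3 x) * fd (x 0))
    (hR : L + δ < R) (hR' : L + δ < R') (μ : Fin 4) :
    N.commVEV μ Φ A = N.commVEV μ Φ' A := by
  rw [← sub_eq_zero, ← N.commVEV_sub]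
  have hdiff : ∀ x, (Φ - Φ') x = (g - g') (spaceC 3 x) * fd (x 0) := by
    intro x
    simp only [sub_apply, hΦ, hΦ', Pi.sub_apply]
    ring
  have hfdc : HasCompactSupport fd :=
    HasCompactSupport.of_support_subset_isCompact isCompact_Icc
      ((subset_tsupport _).trans hfd)
  have hcpt : HasCompactSupport ((Φ - Φ' : 𝓢(SpaceTime 3, ℂ)) : SpaceTime 3 → ℂ) :=
    hasCompactSupport_tensor hdiff (hg.2.1.sub hg'.2.1) hfdc
  have hsupp : tsupport ((Φ - Φ' : 𝓢(SpaceTime 3, ℂ)) : SpaceTime 3 → ℂ) ⊆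
      {x : SpaceTime 3 | min R R' ≤ ‖spaceC 3 x‖ ∧ |x 0| ≤ δ} := by
    refine tsupport_tensor_subset hdiff (fun y hy => ?_) (fun t ht => ?_)
    · rw [lt_min_iff] at hy
      simp [hg.2.2 y hy.1, hg'.2.2 y hy.2]
    · exact eq_zero_of_tsupport_subset_Icc hfd ht
  have hsep : AreSpacelikeSeparated (tsupport ((Φ - Φ' : 𝓢(SpaceTime 3, ℂ)) : SpaceTime 3 → ℂ))
      (krsDiamond L) := fun x hx y hy =>
    areSpacelikeSeparated_shell_krsDiamond (lt_min hR hR') x (hsupp hx) y hy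
  exact hN.cur_local μ _ _ hcpt hsep A hA

/-! ### Lemma I: independence of the time smearing -/

/-- **KRS Lemma I, independence of the time smearing `f_d`** (the part that uses current
conservation). For `A ∈ 𝔄(𝒪_L)`, a space cut-off `g ∈ 𝒟_R` and two smooth time smearings
`f, f'` supported in `[-d, d]` with the same integral, and `R > L + d`:
`(Ω, [j⁰(g f), A] Ω) = (Ω, [j⁰(g f'), A] Ω)`. Proof as printed, (13)-(17): `f - f' = φ'` with
`φ(s) = ∫_{-∞}^{s} (f - f')` supported in `[-d₁, d₁]` (`d < d₁ < R - L`); `g (f - f') = ∂₀(g φ)`,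
so by the continuity equation 5(c) `j⁰(g (f - f')) Ω = -Σᵢ jⁱ((∂ᵢ g) φ) Ω` (and likewise for the
conjugate test function), and each `(∂ᵢ g) φ` is supported at `|x⃗| ≥ R`, `|x⁰| ≤ d₁`, totally
spacelike to `𝒪_L`, where 5(d) kills the commutator.
[cite: KastlerRobinsonSwieca1966, §III Lemma I, (13)-(17)] -/
theorem commVEV_eq_of_timeSmearing {m : ℝ} (hN : N.IsKRS m) {L δ R : ℝ}
    {A : N.H →L[ℂ] N.H} (hA : A ∈ N.alg (krsDiamond L))
    {f f' : ℝ → ℂ} (hf : ContDiff ℝ ∞ f) (hf' : ContDiff ℝ ∞ f')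
    (hsf : tsupport f ⊆ Icc (-δ) δ) (hsf' : tsupport f' ⊆ Icc (-δ) δ)
    (hint : ∫ t, f t = ∫ t, f' t)
    {g : EuclideanSpace ℝ (Fin 3) → ℂ} (hg : IsSpaceCutoff R g)
    {Φ Φ' : 𝓢(SpaceTime 3, ℂ)} (hΦ : ∀ x, Φ x = g (spaceC 3 x) * f (x 0))
    (hΦ' : ∀ x, Φ' x = g (spaceC 3 x) * f' (x 0)) (hR : L + δ < R) :
    N.commVEV 0 Φ A = N.commVEV 0 Φ' A := by
  -- a margin `δ < δ₁` with `L + δ₁ < R`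
  set δ₁ : ℝ := (R - L + δ) / 2 with hδ₁
  have hδδ₁ : δ < δ₁ := by rw [hδ₁]; linarith
  have hLδ₁ : L + δ₁ < R := by rw [hδ₁]; linarith
  -- the difference `u = f - f'` and its primitive `φ`
  set u : ℝ → ℂ := fun t => f t - f' t with hu
  have hu_smooth : ContDiff ℝ ∞ u := hf.sub hf'
  have hu_supp : ∀ t, δ < |t| → u t = 0 := fun t ht => by
    simp only [hu, eq_zero_of_tsupport_subset_Icc hsf ht, eq_zero_of_tsupport_subset_Icc hsf' ht,
      sub_zero]
  have hfc : HasCompactSupport f :=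
    HasCompactSupport.of_support_subset_isCompact isCompact_Icc ((subset_tsupport _).trans hsf)
  have hfc' : HasCompactSupport f' :=
    HasCompactSupport.of_support_subset_isCompact isCompact_Icc ((subset_tsupport _).trans hsf')
  have hu_int : ∫ t, u t = 0 := by
    simp only [hu]
    rw [integral_sub (hf.continuous.integrable_of_hasCompactSupport hfc)
      (hf'.continuous.integrable_of_hasCompactSupport hfc'), hint, sub_self]
  obtain ⟨φ, hφ_smooth, hφ_deriv, hφ_zero⟩ := exists_smooth_primitive hu_smooth hδδ₁ hu_supp hu_int
  have hφ_cpt : HasCompactSupport φ := by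
    refine HasCompactSupport.of_support_subset_isCompact (isCompact_Icc (a := -δ₁) (b := δ₁)) ?_
    intro s hs
    rw [Function.mem_support] at hs
    have : |s| < δ₁ := lt_of_not_ge fun h => hs (hφ_zero s h)
    rw [abs_lt] at this
    exact ⟨this.1.le, this.2.le⟩
  -- the test functions `Θ = g ⊗ φ` and `Ξ i = ∂ᵢ g ⊗ φ`
  obtain ⟨Θ, hΘ⟩ := exists_schwartz_tensor hg.1 hg.2.1 hφ_smooth hφ_cpt
  have hdg_smooth : ∀ i : Fin 3, ContDiff ℝ ∞
      fun y => fderiv ℝ g y (EuclideanSpace.single i (1 : ℝ)) := fun i =>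
    (hg.1.fderiv_right (m := ∞) (by norm_cast)).clm_apply contDiff_const
  have hdg_cpt : ∀ i : Fin 3, HasCompactSupport
      fun y => fderiv ℝ g y (EuclideanSpace.single i (1 : ℝ)) := fun i =>
    hg.2.1.fderiv (𝕜 := ℝ).comp_left (g := fun T : EuclideanSpace ℝ (Fin 3) →L[ℝ] ℂ =>
      T (EuclideanSpace.single i (1 : ℝ))) rfl
  have hΞex : ∀ i : Fin 3, ∃ Ξ : 𝓢(SpaceTime 3, ℂ),
      ∀ x, Ξ x = fderiv ℝ g (spaceC 3 x) (EuclideanSpace.single i 1) * φ (x 0) := fun i =>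
    exists_schwartz_tensor (hdg_smooth i) (hdg_cpt i) hφ_smooth hφ_cpt
  choose Ξ hΞ using hΞex
  have hgd : Differentiable ℝ g := hg.1.differentiable (by simp)
  -- the derivatives of `Θ`
  have hdiffΦ : ∀ x, (Φ - Φ') x = g (spaceC 3 x) * u (x 0) := fun x => by
    simp only [sub_apply, hΦ, hΦ', hu]
    ring
  have h0 : ∂_{(EuclideanSpace.single (0 : Fin 4) (1 : ℝ) : SpaceTime 3)} Θ = Φ - Φ' :=
    lineDerivOp_zero_tensor hgd hφ_deriv hΘ hdiffΦ
  have hi : ∀ i : Fin 3, ∂_{(EuclideanSpace.single i.succ (1 : ℝ) : SpaceTime 3)} Θ = Ξ i :=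
    fun i => lineDerivOp_succ_tensor hgd hφ_deriv hΘ i (hΞ i)
  -- current conservation for `Θ` and `Θ̄`
  have hcons : N.cur 0 (Φ - Φ') = -∑ i : Fin 3, N.cur i.succ (Ξ i) := by
    have h := hN.cur_conserved Θ
    rw [Fin.sum_univ_succ, h0] at h
    simp only [hi] at h
    exact eq_neg_of_add_eq_zero_left h
  have hcons' : N.cur 0 (starTest (Φ - Φ')) = -∑ i : Fin 3, N.cur i.succ (starTest (Ξ i)) := by
    have h := hN.cur_conserved (starTest Θ)
    rw [Fin.sum_univ_succ, lineDerivOp_starTest, h0] at h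
    simp only [lineDerivOp_starTest, hi] at h
    exact eq_neg_of_add_eq_zero_left h
  -- each `Ξ i` is supported in the far shell, spacelike to `𝒪_L`
  have hΞzero : ∀ i : Fin 3, N.commVEV i.succ (Ξ i) A = 0 := by
    intro i
    have hcpt : HasCompactSupport ((Ξ i : 𝓢(SpaceTime 3, ℂ)) : SpaceTime 3 → ℂ) :=
      hasCompactSupport_tensor (hΞ i) (hdg_cpt i) hφ_cpt
    have hsupp : tsupport ((Ξ i : 𝓢(SpaceTime 3, ℂ)) : SpaceTime 3 → ℂ) ⊆
        {x : SpaceTime 3 | R ≤ ‖spaceC 3 x‖ ∧ |x 0| ≤ δ₁} := by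
      refine tsupport_tensor_subset (g := fun y => fderiv ℝ g y (EuclideanSpace.single i 1))
        (hΞ i) (fun y hy => ?_) (fun t ht => hφ_zero t ht.le)
      -- `g = 1` near `y`, so its derivative vanishes
      have hev : g =ᶠ[𝓝 y] fun _ => (1 : ℂ) := by
        filter_upwards [Metric.ball_mem_nhds y (sub_pos.2 hy)] with z hz
        apply hg.2.2 z
        rw [Metric.mem_ball, dist_eq_norm] at hz
        calc ‖z‖ = ‖(z - y) + y‖ := by rw [sub_add_cancel]
          _ ≤ ‖z - y‖ + ‖y‖ := norm_add_le _ _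
          _ < R := by linarith
      rw [hev.fderiv_eq, fderiv_const_apply, zero_apply]
    exact hN.cur_local i.succ _ _ hcpt (fun x hx z hz =>
      areSpacelikeSeparated_shell_krsDiamond hLδ₁ x (hsupp hx) z hz) A hA
  -- assemble
  rw [← sub_eq_zero, ← N.commVEV_sub, commVEV, hcons, hcons']
  simp only [inner_neg_left, inner_neg_right, sum_inner, inner_sum, neg_sub_neg]
  have : ∑ i : Fin 3, N.commVEV i.succ (Ξ i) A = 0 := Finset.sum_eq_zero fun i _ => hΞzero i
  simp only [commVEV] at this
  rw [Finset.sum_sub_distrib] at this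
  rw [sub_eq_zero] at this ⊢
  exact this.symm

/-! ### Lemma I for translated test functions -/

/-- **KRS Lemma I for translates.** For `A ∈ 𝔄(𝒪_L)`, `f_R ⊗ f_d ∈ 𝒟_R ⊗ 𝒟_d` and a
translation `a ∈ ℝ^{1+3}` with `L + d + |a⁰| + |a⃗| < R`, the translated test function
`(f_R f_d)_a(x) = f_R(x⃗ - a⃗) f_d(x⁰ - a⁰)` gives the same charge commutator,
`(Ω, [j⁰((f_R f_d)_a), A] Ω) = (Ω, [j⁰(f_R f_d), A] Ω)`: `f_R(· - a⃗) ∈ 𝒟_{R - |a⃗|}` and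
`f_d(· - a⁰)` is a time smearing of width `d + |a⁰|` with the same integral, so both halves of
Lemma I apply. [cite: KastlerRobinsonSwieca1966, §III Lemma I] -/
theorem commVEV_compSubConstCLM_eq {m : ℝ} (hN : N.IsKRS m) {L δ R : ℝ}
    {A : N.H →L[ℂ] N.H} (hA : A ∈ N.alg (krsDiamond L))
    {fd : ℝ → ℂ} (hfd : IsTimeSmearing δ fd) {g : EuclideanSpace ℝ (Fin 3) → ℂ}
    (hg : IsSpaceCutoff R g) {Ψ : 𝓢(SpaceTime 3, ℂ)}
    (hΨ : ∀ x, Ψ x = g (spaceC 3 x) * fd (x 0)) (a : SpaceTime 3)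
    (ha : L + δ + |a 0| + ‖spaceC 3 a‖ < R) :
    N.commVEV 0 (SchwartzMap.compSubConstCLM ℂ a Ψ) A = N.commVEV 0 Ψ A := by
  obtain ⟨hfd_smooth, hfd_supp, hfd_int⟩ := hfd
  -- the translated factors
  set g' : EuclideanSpace ℝ (Fin 3) → ℂ := fun y => g (y - spaceC 3 a) with hg'
  set f' : ℝ → ℂ := fun s => fd (s - a 0) with hf'
  have hΨa : ∀ x, SchwartzMap.compSubConstCLM ℂ a Ψ x = g' (spaceC 3 x) * f' (x 0) := by
    intro x
    rw [SchwartzMap.compSubConstCLM_apply, hΨ, map_sub, PiLp.sub_apply]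
  have hg'c : IsSpaceCutoff (R - ‖spaceC 3 a‖) g' := by
    refine ⟨hg.1.comp (contDiff_id.sub contDiff_const), ?_, fun y hy => hg.2.2 _ ?_⟩
    · exact hg.2.1.comp_homeomorph (Homeomorph.subRight (spaceC 3 a))
    · calc ‖y - spaceC 3 a‖ ≤ ‖y‖ + ‖spaceC 3 a‖ := norm_sub_le _ _
        _ < R := by linarith
  have hf'_smooth : ContDiff ℝ ∞ f' := hfd_smooth.comp (contDiff_id.sub contDiff_const)
  have hf'_supp : tsupport f' ⊆ Icc (-(δ + |a 0|)) (δ + |a 0|) := by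
    refine closure_minimal (fun s hs => ?_) isClosed_Icc
    rw [Function.mem_support] at hs
    rw [mem_Icc, ← abs_le]
    by_contra h
    apply hs
    apply eq_zero_of_tsupport_subset_Icc hfd_supp
    have := abs_sub_abs_le_abs_sub s (a 0)
    linarith [lt_of_not_ge h]
  have hfd_supp' : tsupport fd ⊆ Icc (-(δ + |a 0|)) (δ + |a 0|) :=
    hfd_supp.trans (Icc_subset_Icc (by linarith [abs_nonneg (a 0)])
      (by linarith [abs_nonneg (a 0)]))
  have hf'_int : ∫ s, f' s = ∫ s, fd s := integral_sub_right_eq_self _ _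
  have hfdc : HasCompactSupport fd :=
    HasCompactSupport.of_support_subset_isCompact isCompact_Icc
      ((subset_tsupport _).trans hfd_supp)
  -- intermediate test function `g' ⊗ f_d`
  obtain ⟨Φ₁, hΦ₁⟩ := exists_schwartz_tensor hg'c.1 hg'c.2.1 hfd_smooth hfdc
  have hR₁ : L + (δ + |a 0|) < R - ‖spaceC 3 a‖ := by linarith
  have hR₂ : L + δ < R - ‖spaceC 3 a‖ := by linarith [abs_nonneg (a 0)]
  have hR₃ : L + δ < R := by linarith [abs_nonneg (a 0), norm_nonneg (spaceC 3 a)]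
  rw [commVEV_eq_of_timeSmearing hN hA hf'_smooth hfd_smooth hf'_supp hfd_supp' hf'_int hg'c
    hΨa hΦ₁ hR₁]
  exact commVEV_eq_of_spaceCutoff hN hA hfd_supp hg'c hg hΦ₁ hΨ hR₂ hR₃ 0

end Literature.Barriers.QuantumFields
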